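import Summits.CriticalPhenomena.PercolationContinuityZ3.Theorems.PercNearOneGluingNoHeavyPcintWindowAutW
import Summits.CriticalPhenomena.PercolationContinuityZ3.Theorems.PercNearOneGluingNoHeavyPcintNawRandReduction
import HarnessLib

/-!
# PCINT lane: window certificates for the B2r (`nawrand_cw`) weight — kernel form

Cell `prim-pcint`, seat `prim-pcint-2`; memo `run/shared/lean/prim/pcint/REDUCTIONS.md` §R2, §B2r.6.
Does NOT build on p205010.

B2r specifics on windows of `m + 1` steps: the genuine window gap set/count `winGapSet`/`winGapTrue`, the
genuine window corner condition `WinCornerTrue`, the time factors `gapFactor` of the full weight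
(`nawRandWeight_eq_prod`), the per-step domination `gapFactor_le_winFactor` (for a neighbour-avoiding word the
full factor at time `t+m+2` is at most the window automaton's factor `q̄^{gw} κ̄^{[cw]}` as soon as the computable
counts are SOUND: `gw ≤ winGapTrue`, `cw → WinCornerTrue`), and the certificate theorem
`le_siteCriticalProb_zd_of_nawRandWindowCert : … → p ≤ p_c^site(ℤ^d)`.
-/

noncomputable section

namespace Summit.CriticalPhenomena.PercolationContinuityZ3.Theorems.Pcint

open Finset Literature.Probability.Percolation Literature.Probability.LatticeModels

variable {d m : ℕ} (a₀ : Fin d × Bool)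

/-! ### B2r specifics: genuine window counts (windows of length `m + 1`) -/

/-- The GENUINE window gap set: lattice neighbours of the new vertex `P_{m+2}` of the extended window, not
among its sites `P_0..P_{m+2}`, with a window incidence `P_i`, `i + 3 ≤ m + 2`. [folklore] -/
def winGapSet (u : Fin (m + 1) → Fin d × Bool) (a : Fin d × Bool) : Finset (Site d) :=
  (nbrSites (wordPos (wext u a) (m + 2))).filter fun w =>
    (∀ j ≤ m + 2, wordPos (wext u a) j ≠ w) ∧
      ∃ i : Fin (m + 3), (i : ℕ) + 3 ≤ m + 2 ∧ (zdGraph d).Adj (wordPos (wext u a) i) w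

/-- Membership in `winGapSet`. [folklore] -/
theorem mem_winGapSet {u : Fin (m + 1) → Fin d × Bool} {a : Fin d × Bool} {w : Site d} :
    w ∈ winGapSet u a ↔ (zdGraph d).Adj (wordPos (wext u a) (m + 2)) w ∧ (∀ j ≤ m + 2, wordPos (wext u a) j ≠ w) ∧
      ∃ i : ℕ, i + 3 ≤ m + 2 ∧ (zdGraph d).Adj (wordPos (wext u a) i) w := by
  rw [winGapSet, mem_filter, mem_nbrSites]
  constructor
  · rintro ⟨h1, h2, i, h3, h4⟩; exact ⟨h1, h2, i, h3, h4⟩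
  · rintro ⟨h1, h2, i, h3, h4⟩; exact ⟨h1, h2, ⟨i, by omega⟩, h3, h4⟩

/-- The GENUINE window gap count. [folklore] -/
def winGapTrue (u : Fin (m + 1) → Fin d × Bool) (a : Fin d × Bool) : ℕ := (winGapSet u a).card

/-- The GENUINE window corner condition: the corner site `P_m + a` of the last two steps is not a window site and
has no window incidence `P_i`, `i < m` (perpendicularity is automatic for accepted windows). [folklore] -/
def WinCornerTrue (u : Fin (m + 1) → Fin d × Bool) (a : Fin d × Bool) : Prop :=
  (∀ j ≤ m + 2, wordPos (wext u a) j ≠ wordPos (wext u a) m + stepVec a) ∧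
    ∀ i < m, ¬ (zdGraph d).Adj (wordPos (wext u a) i) (wordPos (wext u a) m + stepVec a)

open Classical in
/-- The full B2r factor of a word at time `T`: `q^{#gapSet γ T} · κ^{[T ≥ 2 ∧ corner at T-2]}`. [folklore] -/
def gapFactor (q κ : ℝ) {n : ℕ} (γ : Fin n → Fin d × Bool) (T : ℕ) : ℝ :=
  q ^ (gapSet γ T).card * (if 2 ≤ T ∧ IsCorner γ (T - 2) then κ else 1)

/-- Every time factor is nonnegative (for `0 ≤ q`, `0 ≤ κ`). [folklore] -/
theorem gapFactor_nonneg {q κ : ℝ} (hq : 0 ≤ q) (hκ : 0 ≤ κ) {n : ℕ} (γ : Fin n → Fin d × Bool) (T : ℕ) :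
    0 ≤ gapFactor q κ γ T := by
  unfold gapFactor; split_ifs <;> positivity

/-- Every time factor is at most `1` (for `0 ≤ q ≤ 1`, `0 ≤ κ ≤ 1`). [folklore] -/
theorem gapFactor_le_one {q κ : ℝ} (hq : 0 ≤ q) (hq1 : q ≤ 1) (hκ : 0 ≤ κ) (hκ1 : κ ≤ 1) {n : ℕ}
    (γ : Fin n → Fin d × Bool) (T : ℕ) : gapFactor q κ γ T ≤ 1 := by
  unfold gapFactor
  split_ifs
  · exact mul_le_one₀ (pow_le_one₀ hq hq1) hκ hκ1
  · rw [mul_one]; exact pow_le_one₀ hq hq1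

/-- The corner times `s` correspond to the times `T = s + 2 ≤ n`. [folklore] -/
theorem card_filter_corner {n : ℕ} (γ : Fin n → Fin d × Bool) [DecidablePred fun T => 2 ≤ T ∧ IsCorner γ (T - 2)] :
    ((range (n + 1)).filter fun T => 2 ≤ T ∧ IsCorner γ (T - 2)).card = cornerTotal γ := by
  rw [cornerTotal]
  symm
  refine card_bij (fun s _ => (s : ℕ) + 2) (fun s hs => ?_) (fun s₁ _ s₂ _ h => Fin.ext (by omega)) (fun T hT => ?_)
  · have hc := mem_cornerTimes.1 hs
    have h := hc.fst
    refine mem_filter.2 ⟨mem_range.2 (by omega), by omega, ?_⟩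
    rw [Nat.add_sub_cancel]; exact hc
  · obtain ⟨-, h2, hc⟩ := mem_filter.1 hT
    have h := hc.fst
    exact ⟨⟨T - 2, by omega⟩, mem_cornerTimes.2 hc, by simp only; omega⟩

/-- The B2r weight as `p^{n+1}` times the product of its time factors. [folklore] -/
theorem nawRandWeight_eq_prod (p q : ℝ) {n : ℕ} (γ : Fin n → Fin d × Bool) :
    nawRandWeight p q γ = p ^ (n + 1) * ∏ T ∈ range (n + 1), gapFactor q ((1 + q) / 2) γ T := by
  classical
  unfold nawRandWeight gapFactor gapTotal
  rw [prod_mul_distrib, prod_pow_eq_pow_sum, prod_ite, prod_const_one, mul_one, prod_const,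
    card_filter_corner, mul_assoc]

/-! ### Windows of a neighbour-avoiding word -/

/-- A window of a chordless word, extended by its next step, is chordless. [folklore] -/
theorem chordEdges_wext_winAt {N : ℕ} {w : Fin N → Fin d × Bool} (hch : chordEdges w = ∅) {t : ℕ}
    (ht : t + m < N) : chordEdges (wext (winAt (m := m) a₀ w t) (wordAt a₀ w (t + m))) = ∅ := by
  rw [Finset.eq_empty_iff_forall_notMem]
  intro e he
  obtain ⟨i, j, hij, hj, hadj, rfl⟩ := mem_chordEdges.1 he
  rw [wordPos_wext_winAt a₀ w ht (by omega), wordPos_wext_winAt a₀ w ht hj,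
    Literature.Probability.RandomPlanarGeometry.SAW.Zd.zdGraph_adj_sub_right] at hadj
  have : s(wordPos w (t + i), wordPos w (t + j)) ∈ chordEdges w :=
    mem_chordEdges.2 ⟨t + i, t + j, by omega, by omega, hadj, rfl⟩
  rw [hch] at this
  exact Finset.notMem_empty _ this

/-- In a chordless self-avoiding word, lattice-adjacent sites are consecutive. [folklore] -/
theorem consecutive_of_adj {N : ℕ} {w : Fin N → Fin d × Bool} (hch : chordEdges w = ∅)
    {i j : ℕ} (hi : i ≤ N) (hj : j ≤ N) (hadj : (zdGraph d).Adj (wordPos w i) (wordPos w j)) :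
    i + 1 = j ∨ j + 1 = i := by
  by_contra hne
  push Not at hne
  have hij : i ≠ j := fun h => by rw [h] at hadj; exact hadj.ne rfl
  rcases Nat.lt_or_gt_of_ne hij with h | h
  · have : s(wordPos w i, wordPos w j) ∈ chordEdges w := mem_chordEdges.2 ⟨i, j, by omega, hj, hadj, rfl⟩
    rw [hch] at this; exact Finset.notMem_empty _ this
  · have : s(wordPos w j, wordPos w i) ∈ chordEdges w := mem_chordEdges.2 ⟨j, i, by omega, hi, hadj.symm, rfl⟩
    rw [hch] at this; exact Finset.notMem_empty _ this

/-- **Translated window gap sites are full gap sites** of a neighbour-avoiding word (time `t + m + 2`). [folklore] -/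
theorem mem_gapSet_of_mem_winGapSet {k : ℕ} {γ : Fin (m + 1 + k) → Fin d × Bool}
    (hch : chordEdges γ = ∅) {t : ℕ} (ht : t < k) {w' : Site d}
    (hw' : w' ∈ winGapSet (winAt (m := m + 1) a₀ γ t) (wordAt a₀ γ (t + (m + 1)))) :
    w' + wordPos γ t ∈ gapSet γ (t + m + 2) := by
  have htm : t + (m + 1) < m + 1 + k := by omega
  obtain ⟨hadj, hoff, i, hi3, hiw⟩ := mem_winGapSet.1 hw'
  rw [wordPos_wext_winAt a₀ γ htm le_rfl] at hadj
  rw [wordPos_wext_winAt a₀ γ htm (by omega)] at hiw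
  have hadj' : (zdGraph d).Adj (wordPos γ (t + m + 2)) (w' + wordPos γ t) := by
    rw [← Literature.Probability.RandomPlanarGeometry.SAW.Zd.zdGraph_adj_sub_right _ _ (wordPos γ t),
      add_sub_cancel_right, show t + m + 2 = t + (m + 1 + 1) by ring]; exact hadj
  have hiw' : (zdGraph d).Adj (wordPos γ (t + i)) (w' + wordPos γ t) := by
    rw [← Literature.Probability.RandomPlanarGeometry.SAW.Zd.zdGraph_adj_sub_right _ _ (wordPos γ t),
      add_sub_cancel_right]; exact hiw
  refine mem_gapSet.2 ⟨hadj', fun hmem => ?_, t + i, by omega, hiw'⟩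
  obtain ⟨h, hh, hhw⟩ := mem_pathSites.1 hmem
  rw [← hhw] at hadj' hiw'
  rcases consecutive_of_adj hch (by omega) hh hadj' with h1 | h1
  · rcases consecutive_of_adj hch (by omega) hh hiw' with h2 | h2 <;> omega
  · refine hoff (m + 1) (by omega) ?_
    rw [wordPos_wext_winAt a₀ γ htm (by omega), show t + (m + 1) = h by omega, hhw, add_sub_cancel_right]

/-- The genuine window gap count is at most the full gap count. [folklore] -/
theorem winGapTrue_le_card_gapSet {k : ℕ} {γ : Fin (m + 1 + k) → Fin d × Bool}
    (hch : chordEdges γ = ∅) {t : ℕ} (ht : t < k) :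
    winGapTrue (winAt (m := m + 1) a₀ γ t) (wordAt a₀ γ (t + (m + 1))) ≤ (gapSet γ (t + m + 2)).card := by
  unfold winGapTrue
  exact Finset.card_le_card_of_injOn (fun w' => w' + wordPos γ t)
    (fun w' hw' => mem_coe.2 (mem_gapSet_of_mem_winGapSet a₀ hch ht (mem_coe.1 hw')))
    (fun x _ y _ h => add_right_cancel h)

/-- **A sound window corner that is not a full corner is a full gap event**, distinct from the window gap
events: then the full gap set has more than `winGapTrue` elements. [folklore] -/
theorem winGapTrue_lt_card_gapSet {k : ℕ} {γ : Fin (m + 1 + k) → Fin d × Bool} (hs : IsSAW γ)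
    (hch : chordEdges γ = ∅) {t : ℕ} (ht : t < k)
    (hwc : WinCornerTrue (winAt (m := m + 1) a₀ γ t) (wordAt a₀ γ (t + (m + 1))))
    (hnc : ¬ IsCorner γ (t + m)) :
    winGapTrue (winAt (m := m + 1) a₀ γ t) (wordAt a₀ γ (t + (m + 1))) < (gapSet γ (t + m + 2)).card := by
  have htm : t + (m + 1) < m + 1 + k := by omega
  have ha : wordAt a₀ γ (t + (m + 1)) = γ ⟨t + m + 1, by omega⟩ := wordAt_of_lt a₀ γ htm
  -- window positions `m`, `m + 1` are `v_{t+m} - v_t`, `v_{t+m+1} - v_t`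
  have hPm : wordPos (wext (winAt (m := m + 1) a₀ γ t) (wordAt a₀ γ (t + (m + 1)))) m
      = wordPos γ (t + m) - wordPos γ t := wordPos_wext_winAt a₀ γ htm (by omega)
  have hPm1 : wordPos (wext (winAt (m := m + 1) a₀ γ t) (wordAt a₀ γ (t + (m + 1)))) (m + 1)
      = wordPos γ (t + m + 1) - wordPos γ t := by
    rw [wordPos_wext_winAt a₀ γ htm (by omega), show t + (m + 1) = t + m + 1 by ring]
  obtain ⟨hoff, hnoinc⟩ := hwc
  rw [hPm] at hoff hnoinc
  -- the translated corner site `c = v_{t+m} + e(γ_{t+m+1}) = cornerSite γ (t+m)`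
  have hcs : cornerSite γ (t + m) = wordPos γ (t + m) + stepVec (wordAt a₀ γ (t + (m + 1))) := by
    rw [cornerSite, dif_pos (by omega : t + m + 1 < m + 1 + k), ha]
  have hT1 : wordPos γ (t + m + 1) = wordPos γ (t + m) + stepVec (γ ⟨t + m, by omega⟩) :=
    wordPos_succ γ (by omega)
  have hT2 : wordPos γ (t + m + 2) = wordPos γ (t + m + 1) + stepVec (wordAt a₀ γ (t + (m + 1))) := by
    rw [ha]; exact wordPos_succ γ (by omega)
  have hstep : wordPos γ (t + m + 2) = cornerSite γ (t + m) + stepVec (γ ⟨t + m, by omega⟩) := by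
    rw [hT2, hT1, hcs]; abel
  have hadjT : (zdGraph d).Adj (wordPos γ (t + m + 2)) (cornerSite γ (t + m)) := by
    rw [(zdGraph d).adj_comm, zdGraph_adj_iff_stepVec]; exact ⟨_, hstep⟩
  have hadjS : (zdGraph d).Adj (wordPos γ (t + m)) (cornerSite γ (t + m)) := by
    rw [zdGraph_adj_iff_stepVec]; exact ⟨_, hcs⟩
  -- the corner site is not `v_{t+m+1}` (a window site)
  have hne1 : cornerSite γ (t + m) ≠ wordPos γ (t + m + 1) := by
    intro he
    refine hoff (m + 1) (by omega) ?_
    rw [hPm1, ← he, hcs]; abel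
  -- (2) the corner site is off the path
  have hcoff : cornerSite γ (t + m) ∉ pathSites γ := by
    intro hmem
    obtain ⟨h, hh, hhc⟩ := mem_pathSites.1 hmem
    rw [← hhc] at hadjT hadjS hne1
    rcases consecutive_of_adj hch (by omega) hh hadjT with h1 | h1 <;>
      rcases consecutive_of_adj hch (by omega) hh hadjS with h2 | h2 <;> try omega
    exact hne1 (by rw [show h = t + m + 1 by omega])
  -- (3) an old incidence exists since the full corner condition fails
  have hold : ∃ i, i + 3 ≤ t + m + 2 ∧ (zdGraph d).Adj (wordPos γ i) (cornerSite γ (t + m)) := by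
    by_contra hno
    push Not at hno
    apply hnc
    refine ⟨by omega, ?_, hcoff, fun i hi => hno i (by have := mem_range.1 hi; omega)⟩
    -- perpendicularity: same axis would make the corner site a window site or break self-avoidance
    intro hax
    by_cases hsg : (γ ⟨t + m, by omega⟩).2 = (γ ⟨t + m + 1, by omega⟩).2
    · have heq : γ ⟨t + m, by omega⟩ = γ ⟨t + m + 1, by omega⟩ := Prod.ext hax hsg
      exact hne1 (by rw [hcs, ha, ← heq, ← hT1])
    · have hrev : γ ⟨t + m, by omega⟩ = srev (γ ⟨t + m + 1, by omega⟩) := by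
        rw [srev]; refine Prod.ext hax ?_
        cases hb : (γ ⟨t + m, by omega⟩).2 <;> cases hb' : (γ ⟨t + m + 1, by omega⟩).2 <;> simp_all
      have hTS : wordPos γ (t + m + 2) = wordPos γ (t + m) := by
        rw [hstep, hcs, ha, hrev, stepVec_srev]; abel
      have := hs (t + m + 2) (t + m) (by omega) (by omega) hTS
      omega
  obtain ⟨i, hi3, hic⟩ := hold
  have hcg : cornerSite γ (t + m) ∈ gapSet γ (t + m + 2) := mem_gapSet.2 ⟨hadjT, hcoff, i, hi3, hic⟩
  -- the translated window gap sites miss the corner site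
  have himg : (winGapSet (winAt (m := m + 1) a₀ γ t) (wordAt a₀ γ (t + (m + 1)))).image
      (fun w' => w' + wordPos γ t) ⊆ (gapSet γ (t + m + 2)).erase (cornerSite γ (t + m)) := by
    intro x hx
    rw [mem_image] at hx
    obtain ⟨w', hw', rfl⟩ := hx
    refine mem_erase.2 ⟨fun hx => ?_, mem_gapSet_of_mem_winGapSet a₀ hch ht hw'⟩
    obtain ⟨-, -, i', hi'3, hi'w⟩ := mem_winGapSet.1 hw'
    refine hnoinc i' (by omega) ?_
    rw [wordPos_wext_winAt a₀ γ htm (by omega)] at hi'w ⊢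
    have hw'c : w' = cornerSite γ (t + m) - wordPos γ t := by rw [← hx, add_sub_cancel_right]
    rw [show wordPos γ (t + m) - wordPos γ t + stepVec (wordAt a₀ γ (t + (m + 1)))
        = cornerSite γ (t + m) - wordPos γ t by rw [hcs]; abel, ← hw'c]
    exact hi'w
  unfold winGapTrue
  calc (winGapSet _ _).card = ((winGapSet (winAt (m := m + 1) a₀ γ t) (wordAt a₀ γ (t + (m + 1)))).image
        fun w' => w' + wordPos γ t).card :=
        (card_image_of_injective _ (add_left_injective (wordPos γ t))).symm
    _ ≤ ((gapSet γ (t + m + 2)).erase (cornerSite γ (t + m))).card := card_le_card himg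
    _ < (gapSet γ (t + m + 2)).card := card_erase_lt_of_mem hcg

/-- **Per-step domination** (REDUCTIONS §B2r.6): for a neighbour-avoiding word, the full B2r factor at time
`t + m + 2` is at most the window automaton's factor `q̄^{gw} κ̄^{[cw]}` whenever the computable counts are sound
(`gw ≤ winGapTrue`, `cw → WinCornerTrue`) and `q ≤ q̄ ≤ 1`, `(1+q̄)/2 ≤ κ̄`. [folklore] -/
theorem gapFactor_le_winFactor {k : ℕ} {γ : Fin (m + 1 + k) → Fin d × Bool} (hs : IsSAW γ)
    (hch : chordEdges γ = ∅) {t : ℕ} (ht : t < k) {gw : ℕ} {cw : Bool}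
    (hgw : gw ≤ winGapTrue (winAt (m := m + 1) a₀ γ t) (wordAt a₀ γ (t + (m + 1))))
    (hcw : cw = true → WinCornerTrue (winAt (m := m + 1) a₀ γ t) (wordAt a₀ γ (t + (m + 1))))
    {q qb κb : ℝ} (hq0 : 0 ≤ q) (hqb : q ≤ qb) (hqb1 : qb ≤ 1) (hκb : (1 + qb) / 2 ≤ κb) :
    gapFactor q ((1 + q) / 2) γ (t + m + 2) ≤ qb ^ gw * (if cw then κb else 1) := by
  classical
  have hqb0 : 0 ≤ qb := hq0.trans hqb
  have hq1 : q ≤ 1 := hqb.trans hqb1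
  have hqκ : q ≤ κb := by linarith
  have hg : gw ≤ (gapSet γ (t + m + 2)).card := hgw.trans (winGapTrue_le_card_gapSet a₀ hch ht)
  have hpow : q ^ (gapSet γ (t + m + 2)).card ≤ qb ^ gw :=
    (pow_le_pow_of_le_one hq0 hq1 hg).trans (pow_le_pow_left₀ hq0 hqb _)
  unfold gapFactor
  rw [show t + m + 2 - 2 = t + m by omega]
  cases cw
  · simp only [Bool.false_eq_true, if_false, mul_one]
    split_ifs
    · exact (mul_le_of_le_one_right (pow_nonneg hq0 _) (by linarith)).trans hpow
    · rw [mul_one]; exact hpow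
  · simp only [if_true]
    split_ifs with hcor
    · exact mul_le_mul hpow (by linarith) (by linarith) (pow_nonneg hqb0 _)
    · rw [mul_one]
      have hlt := winGapTrue_lt_card_gapSet a₀ hs hch ht (hcw rfl) (fun h => hcor ⟨by omega, h⟩)
      calc q ^ (gapSet γ (t + m + 2)).card ≤ q ^ (gw + 1) := pow_le_pow_of_le_one hq0 hq1 (by omega)
        _ = q ^ gw * q := pow_succ _ _
        _ ≤ qb ^ gw * κb := mul_le_mul (pow_le_pow_left₀ hq0 hqb _) hqκ hq0 (pow_nonneg hqb0 _)

/-! ### The certificate theorem -/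

/-- **B2r window certificate ⇒ lower bound on `p_c^site(ℤ^d)`** (kernel form of REDUCTIONS §R2.5 for kind
`nawrand_cw`, windows of `m + 1` steps).  Data: an acceptance test `ok` accepting every neighbour-avoiding
extended window; computable counts `gw ≤ winGapTrue` and `cw → WinCornerTrue`; constants `0 ≤ q ≤ q̄ ≤ 1`,
`q^{2d-1} ≥ 1 - p`, `(1+q̄)/2 ≤ κ̄`; and a positive vector `v` with the Collatz–Wielandt inequalities
`Σ_a [ok u a] p q̄^{gw u a} κ̄^{[cw u a]} v(wshift u a) ≤ λ v(u)`, `λ < 1`.  Then `p ≤ p_c^site(ℤ^d)`. [folklore] -/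
theorem le_siteCriticalProb_zd_of_nawRandWindowCert (a₀ : Fin d × Bool)
    (ok : (Fin (m + 1) → Fin d × Bool) → Fin d × Bool → Bool) (gw : (Fin (m + 1) → Fin d × Bool) → Fin d × Bool → ℕ)
    (cw : (Fin (m + 1) → Fin d × Bool) → Fin d × Bool → Bool)
    (hok : ∀ u a, IsSAW (wext u a) → chordEdges (wext u a) = ∅ → ok u a = true)
    (hg : ∀ u a, IsSAW (wext u a) → chordEdges (wext u a) = ∅ → gw u a ≤ winGapTrue u a)
    (hc : ∀ u a, IsSAW (wext u a) → chordEdges (wext u a) = ∅ → cw u a = true → WinCornerTrue u a)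
    (p : unitInterval) {q qb κb : ℝ} (hq0 : 0 ≤ q) (hqb : q ≤ qb) (hqb1 : qb ≤ 1) (hκb : (1 + qb) / 2 ≤ κb)
    (hpq : 1 - (p : ℝ) ≤ q ^ (2 * d - 1))
    (v : (Fin (m + 1) → Fin d × Bool) → ℝ) {vmin vmax lam : ℝ} (hvmin : 0 < vmin)
    (hv : ∀ u, vmin ≤ v u) (hvmax : ∀ u, v u ≤ vmax) (hlam0 : 0 < lam) (hlam1 : lam < 1)
    (hcw : ∀ u, (∑ a : Fin d × Bool, if ok u a then
      (p : ℝ) * (qb ^ gw u a * (if cw u a then κb else 1)) * v (wshift u a) else 0) ≤ lam * v u) :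
    (p : ℝ) ≤ siteCriticalProb (zdGraph d) 0 := by
  classical
  have hp0 : (0 : ℝ) ≤ p := p.2.1
  have hp1 : (p : ℝ) ≤ 1 := p.2.2
  have hqb0 : 0 ≤ qb := hq0.trans hqb
  have hκb0 : 0 ≤ κb := by linarith
  have hq1 : q ≤ 1 := hqb.trans hqb1
  have hκ0 : (0 : ℝ) ≤ (1 + q) / 2 := by linarith
  have hκ1 : (1 + q) / 2 ≤ 1 := by linarith
  set wt : (Fin (m + 1) → Fin d × Bool) → Fin d × Bool → ℝ :=
    fun u a => (p : ℝ) * (qb ^ gw u a * (if cw u a then κb else 1)) with hwt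
  have hwt0 : ∀ u a, 0 ≤ wt u a := fun u a => by
    rw [hwt]; dsimp only; split_ifs <;> positivity
  set M := windowAutW ok wt hwt0 with hM
  have hcw' : ∀ u, M.stepSum v u ≤ lam * v u := fun u => by rw [hM, stepSum_windowAutW]; exact hcw u
  -- domination on neighbour-avoiding words of length `(m + 1) + k`
  have hdom : ∀ (k : ℕ) (γ : Fin (m + 1 + k) → Fin d × Bool),
      γ ∈ (sawWords d (m + 1 + k)).filter (fun w => chordEdges w = ∅) →
      nawRandWeight p q γ ≤ (p : ℝ) ^ (m + 2) * M.run k (winAt a₀ γ 0) (fun j => γ ⟨m + 1 + j.1, by omega⟩) := by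
    intro k γ hγ
    obtain ⟨hsaw, hch⟩ := mem_filter.1 hγ
    have hs : IsSAW γ := mem_sawWords.1 hsaw
    have hwin : ∀ t < k, IsSAW (wext (winAt (m := m + 1) a₀ γ t) (wordAt a₀ γ (t + (m + 1)))) ∧
        chordEdges (wext (winAt (m := m + 1) a₀ γ t) (wordAt a₀ γ (t + (m + 1)))) = ∅ :=
      fun t ht => ⟨isSAW_wext_winAt a₀ hs (by omega), chordEdges_wext_winAt a₀ hch (by omega)⟩
    rw [hM, run_windowAutW_eq a₀ ok wt hwt0 k γ (fun t ht => hok _ _ (hwin t ht).1 (hwin t ht).2),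
      nawRandWeight_eq_prod, show m + 1 + k + 1 = (m + 2) + k by ring, Finset.prod_range_add, pow_add,
      mul_assoc]
    refine mul_le_mul_of_nonneg_left ?_ (pow_nonneg hp0 _)
    have hprod : ∏ t ∈ range k, wt (winAt a₀ γ t) (wordAt a₀ γ (t + (m + 1))) =
        (p : ℝ) ^ k * ∏ t ∈ range k, (qb ^ gw (winAt a₀ γ t) (wordAt a₀ γ (t + (m + 1))) *
          (if cw (winAt a₀ γ t) (wordAt a₀ γ (t + (m + 1))) then κb else 1)) := by
      rw [hwt, prod_mul_distrib, prod_const, card_range]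
    rw [hprod]
    refine mul_le_mul_of_nonneg_left ?_ (pow_nonneg hp0 _)
    calc (∏ T ∈ range (m + 2), gapFactor q ((1 + q) / 2) γ T) *
          ∏ t ∈ range k, gapFactor q ((1 + q) / 2) γ (m + 2 + t)
        ≤ 1 * ∏ t ∈ range k, (qb ^ gw (winAt a₀ γ t) (wordAt a₀ γ (t + (m + 1))) *
            (if cw (winAt a₀ γ t) (wordAt a₀ γ (t + (m + 1))) then κb else 1)) :=
          mul_le_mul (prod_le_one (fun T _ => gapFactor_nonneg hq0 hκ0 γ T)
              fun T _ => gapFactor_le_one hq0 hq1 hκ0 hκ1 γ T)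
            (prod_le_prod (fun T _ => gapFactor_nonneg hq0 hκ0 γ _) fun t ht => by
              have ht' := mem_range.1 ht
              rw [show m + 2 + t = t + m + 2 by ring]
              exact gapFactor_le_winFactor a₀ hs hch ht' (hg _ _ (hwin t ht').1 (hwin t ht').2)
                (hc _ _ (hwin t ht').1 (hwin t ht').2) hq0 hqb hqb1 hκb)
            (prod_nonneg fun T _ => gapFactor_nonneg hq0 hκ0 γ _) zero_le_one
      _ = _ := one_mul _
  obtain ⟨C, hC⟩ := sum_le_geometric_of_windowCertW a₀ ok wt hwt0
    (fun n => (sawWords d n).filter fun w => chordEdges w = ∅) (fun n γ => nawRandWeight p q γ)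
    (fun n γ _ => by
      unfold nawRandWeight
      exact mul_le_one₀ (mul_le_one₀ (pow_le_one₀ hp0 hp1) (pow_nonneg hq0 _) (pow_le_one₀ hq0 hq1))
        (pow_nonneg hκ0 _) (pow_le_one₀ hκ0 hκ1))
    (pow_nonneg hp0 (m + 2)) (pow_le_one₀ hp0 hp1) hdom v hvmin hv hvmax hlam0 hcw'
  exact le_siteCriticalProb_zd_of_nawRand_le_geometric d p hq0 hq1 hpq hlam0.le hlam1 hC

end Summit.CriticalPhenomena.PercolationContinuityZ3.Theorems.Pcint
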